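/-
Q_C AS TYPED IS FALSE (rh-split cell, K-lane; seat rh-split-ref g13 = refuter acting as functional referee, 2026-08-28;
lead RULING #512).  NEGATIVE RECORD for the «OPEN question» `IntegerWindowTheft` typed (statement only, «neither asserted
nor denied») in `Theorems/Splittings/PrimeWindowBlindnessClass.lean` l.181 (rh-idea-4 g3 / typer-3 g5; B27/B33
«PRIME-WINDOW BLINDNESS», clause 3 «exactness × integrality», K7′).  FINDING OF RECORD: that decl is FALSE AS TYPED for
every window `U` and width `σ*` — its multiplicity clause `∀ ρ : ℂ, (n ρ : ℤ) ≤ riemannZetaZeroOrder ρ` is tested at the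
POLE `ρ = 1`, where `riemannZetaZeroOrder 1 = -1` (`riemannZetaZeroOrder_one_holds`) while `0 ≤ n 1`; class
refuted-MISSTATED (the prose means «a sub-multiset `n ≤ m` of the TRUE zeros»).  The repaired questions C′/C″ are typed in
the companion module `Theorems/Splittings/Negative/PrimeWindowBlindnessQCRetyped.lean`; the old decl is left in place
(landed declarations are never edited) and occurs in no theorem.  `--supports stmt-RiemannHypothesis-21693`; std axioms;
nothing `private`, no `instance`, no notation.  Nothing here bears on the truth of RH.
-/
import Summits.RiemannHypothesis.RiemannHypothesis.Theorems.Splittings.PrimeWindowBlindnessClass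
import Literature.NumberTheory.LFunctions.ZetaZerosProofs
import HarnessLib

/-!
# `IntegerWindowTheft U σ*` is false for every `U`, `σ*` (junk reason: the pole of `ζ` at `s = 1`)

`not_integerWindowTheft_as_typed`: the theft-multiplicity bound of `IntegerWindowTheft` was quantified over every
`ρ : ℂ`, including the pole `ρ = 1` with `m(1) = -1 < 0 ≤ n 1`.  Consequences for the record: the header caveat of
`PrimeWindowBlindnessClass` «TRUE for `U ≤ 0` (theft `n = 0`)» fails as typed (`not_integerWindowTheft_window_zero`);
«NO for all `U ≥ U₀`» holds trivially as typed — for the wrong reason; any K7′ theft construction would fail to inhabit the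
decl at that clause.  Every K-lane statement about Q_C refers henceforth to the re-typed `IntegerWindowTheft'` (C′) /
`IntegerWindowTheftOnLine` (C″) of the companion module.
-/

noncomputable section

set_option linter.dupNamespace false

namespace Summit.RiemannHypothesis.RiemannHypothesis.Theorems.Splittings.ScrewLatticeTower

open Literature.NumberTheory.LFunctions

/-- **Q_C as typed is false** for every window `U` and width `σ*`: the multiplicity clause of `IntegerWindowTheft`
is tested at the pole `s = 1`, where `riemannZetaZeroOrder 1 = -1` (`riemannZetaZeroOrder_one_holds`). -/
theorem not_integerWindowTheft_as_typed (U σs : ℝ) : ¬ IntegerWindowTheft U σs := by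
  rintro ⟨Z, n, -, -, -, -, -, hn, -, -⟩
  have h := hn 1
  have h1 : riemannZetaZeroOrder 1 = -1 := riemannZetaZeroOrder_one_holds
  rw [h1] at h
  have h0 : (0 : ℤ) ≤ (n 1 : ℤ) := Int.natCast_nonneg _
  omega

/-- In particular the header caveat «`IntegerWindowTheft U σ*` is TRUE for `U ≤ 0`» of `PrimeWindowBlindnessClass`
fails as typed (window `U = 0`, width `1`; the theft `n = 0` still violates the clause at the pole). -/
theorem not_integerWindowTheft_window_zero : ¬ IntegerWindowTheft 0 1 :=
  not_integerWindowTheft_as_typed 0 1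

end Summit.RiemannHypothesis.RiemannHypothesis.Theorems.Splittings.ScrewLatticeTower

end
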